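import Mathlib.AlgebraicGeometry.OpenImmersion
import Mathlib.AlgebraicGeometry.Noetherian
import Mathlib.RingTheory.RegularLocalRing.Defs
import Mathlib.RingTheory.Invariant.Basic
import Mathlib.RingTheory.FiniteType
import Mathlib.RingTheory.Adjoin.Tower
import Mathlib.RingTheory.IntegralClosure.IsIntegralClosure.Basic
import Mathlib.Algebra.Module.PUnit
import Mathlib.RingTheory.LocalProperties.IntegrallyClosed
import Mathlib.RingTheory.Localization.LocalizationLocalization
import Mathlib.RingTheory.Localization.InvSubmonoid
import Literature.AlgebraicGeometry.Resolution.RegularLocalRingsNormal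
import Literature.AlgebraicGeometry.RelativeSpec.FiniteGroupQuotient
import Literature.AlgebraicGeometry.Motives.GoodReductionSpecialFibreProofs
import HarnessLib

/-!
# Finite quotient singularity presentations: `Y` is Zariski-locally `Spec S^G`, `S` regular

Topic: `Literature/AlgebraicGeometry/Resolution`. A DEFINITION requested by route
`ResolutionOfSingularities/WildQuotient`, whose crux items `WildQuotientResolution` and
`GaloisQuotientAlteration` (`Summits/…/Theses/WildQuotient.lean`) inline the condition verbatim, and
a sibling of the named fact `BerghRydh2019_diagonalizableQuotientResolution`
(`TameQuotientSingularitiesResolution.lean`, the graded-algebra rendering of the diagonalizable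
tame case).

## The notion

`HasFiniteQuotientSingularityPresentation k Y`: every point of the scheme `Y` has an open
neighbourhood isomorphic (by an open immersion `Spec S^G ⟶ Y`) to the spectrum of the ring of
invariants `S^G = FixedPoints.subalgebra k S G` of a finite (abstract) group `G` acting by
`k`-algebra automorphisms on a regular, finitely generated `k`-domain `S` — "`Y` is Zariski-locally
the quotient `X'/G = Spec S^G` of a regular affine `k`-variety `X' = Spec S` by a finite group".

Sources. This is the shape of singularity left over by de Jong's theorem — "Any integral scheme
separated, flat and of finite type over `Spec ℤ` has resolution of singularities up to quotient
singularities" / "… the singularities of `X` can be resolved up to quotient singularities and a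
purely inseparable extension of `R(X)`" [cite: DeJong1997, Cor. 5.14 and Cor. 5.15 (p. 620)],
the quotient being `X'/G` for a Galois alteration `(X', G)` with `X'` regular (loc. cit.,
Situation 5.3, (5.12.1), Thm 5.13) — and the Zariski-local, arbitrary-finite-group analogue of
Bergh–Rydh's "Let `k` be a perfect field, and let `X` be an integral scheme over `k`. We say
that `X` has finite tame quotient singularities if étale-locally on `X`, there exists a finite
linearly reductive group scheme `G` over `k` and `G`-scheme `U`, smooth over `k`, such that
`X = U/G`." [cite: BerghRydh2019, definition preceding Thm 5 (arXiv:1905.00872, p. 4)]. The affine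
quotient `U/G = Spec S^G` of `U = Spec S` by a finite group is Mumford, *Abelian Varieties*, §7,
Theorem on p. 66.

Rendering choices (all forced by the requesting items, which this predicate must match
definitionally — `hasFiniteQuotientSingularityPresentation_iff` is `Iff.rfl`):
* Zariski-local (open immersions `Spec S^G ⟶ Y`), not étale-local;
* `G` an arbitrary finite abstract group (wild actions in characteristic `p` allowed), acting
  through `MulSemiringAction G S` with `SMulCommClass G k S` (i.e. by `k`-algebra automorphisms);
* `S` a domain, of finite type over `k`, and REGULAR (`IsRegularRing`, all localisations at primes
  are regular local rings) rather than smooth over `k` (the same thing over a perfect field);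
* no compatibility of the charts with a structure morphism `Y ⟶ Spec k` is recorded (the items
  do not record one).

## API

* `hasFiniteQuotientSingularityPresentation_iff` — unfolding.
* Invariant theory of the chart rings (E. Noether): `S` is integral and module-finite over `S^G`
  (`isIntegral_fixedPointsSubalgebra`, `finite_fixedPointsSubalgebra`), `S^G` is of finite type
  over `k` (`finiteType_fixedPointsSubalgebra`, Noether's finiteness theorem via Artin–Tate),
  Noetherian, a domain.
* `HasFiniteQuotientSingularityPresentation.spec_fixedPoints` — the model `Spec S^G` is presented;
  `.spec_of_isRegularRing` — trivial-group case: a regular affine `k`-variety `Spec S` is presented;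
  `.of_forall_exists` / `.of_openCover` / `.of_isIso` — the notion is local on `Y` and stable
  under isomorphisms (open immersions into `Y` from presented schemes present their images);
  `.isLocallyNoetherian` — a presented scheme is locally Noetherian.
* Normality: `isIntegrallyClosed_of_isRegularRing` (regular domains are normal, from Matsumura
  19.4 in `RegularLocalRingsNormal.lean`), `isIntegrallyClosed_fixedPointsSubalgebra` (invariants
  of a normal domain are normal), `isDomain_stalk_spec`, and (with
  `Motives.isIntegrallyClosed_stalk_Spec`)
  `HasFiniteQuotientSingularityPresentation.isIntegrallyClosed_stalk` / `.isDomain_stalk` — a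
  presented scheme is normal.
* Localisation: `smulAwayMap`, `awayMulSemiringAction` (the `G`-action on `S[1/t]` for an invariant
  `t`), `forall_smulAwayMap_eq_iff` (`(S[1/t])^G = S^G[1/t]`, via
  `RelativeSpec.forall_apply_eq_iff_of_isLocalization`), `isRegularRing_localization`, and
  `HasFiniteQuotientSingularityPresentation.of_isOpenImmersion` / `.restrict` — stability under
  open immersions `U ⟶ Y` (restriction to open subschemes).
-/

noncomputable section

open CategoryTheory AlgebraicGeometry

namespace Literature.AlgebraicGeometry.Resolution

universe u

/-- **`Y` has a finite quotient singularity presentation over `k`**: every point `y : Y` lies in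
the image of an open immersion `Spec S^G ⟶ Y`, where `S` is a regular finitely generated
`k`-domain, `G` is a finite group acting on `S` by `k`-algebra automorphisms, and
`S^G = FixedPoints.subalgebra k S G` is the ring of invariants — "`Y` is Zariski-locally the
quotient of a regular affine `k`-variety by a finite group" (de Jong: resolution "up to quotient
singularities", the quotients `X'/G` of regular Galois alterations; Bergh–Rydh: "finite (tame)
quotient singularities", here Zariski-locally, for arbitrary finite groups, with `S` regular).
[cite: DeJong1997, Cor. 5.14–5.15 (p. 620)]
[cite: BerghRydh2019, definition preceding Thm 5 (arXiv:1905.00872, p. 4)] -/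
def HasFiniteQuotientSingularityPresentation (k : Type u) [Field k] (Y : Scheme.{u}) : Prop :=
  ∀ y : Y, ∃ (G : Type u) (_ : Group G) (_ : Finite G) (S : Type u) (_ : CommRing S)
    (_ : IsDomain S) (_ : Algebra k S) (_ : MulSemiringAction G S) (_ : SMulCommClass G k S),
    Algebra.FiniteType k S ∧ IsRegularRing S ∧
      ∃ φ : Spec (.of (FixedPoints.subalgebra k S G)) ⟶ Y,
        IsOpenImmersion φ ∧ y ∈ Set.range φ.base

variable {k : Type u} [Field k]

/-- Unfolding of `HasFiniteQuotientSingularityPresentation` (definitional; this is the hypothesis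
inlined verbatim by route WildQuotient's items). [folklore] -/
theorem hasFiniteQuotientSingularityPresentation_iff (Y : Scheme.{u}) :
    HasFiniteQuotientSingularityPresentation k Y ↔
      ∀ y : Y, ∃ (G : Type u) (_ : Group G) (_ : Finite G) (S : Type u) (_ : CommRing S)
        (_ : IsDomain S) (_ : Algebra k S) (_ : MulSemiringAction G S) (_ : SMulCommClass G k S),
        Algebra.FiniteType k S ∧ IsRegularRing S ∧
          ∃ φ : Spec (.of (FixedPoints.subalgebra k S G)) ⟶ Y,
            IsOpenImmersion φ ∧ y ∈ Set.range φ.base :=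
  Iff.rfl

/-! ## Invariants of a finite group acting on a finitely generated algebra -/

section Invariants

variable (k) (S : Type u) [CommRing S] [Algebra k S] (G : Type u) [Group G]
  [MulSemiringAction G S] [SMulCommClass G k S]

/-- Tautologically, every `G`-invariant element of `S` lies in `S^G`. [folklore] -/
instance isInvariant_fixedPointsSubalgebra :
    Algebra.IsInvariant (FixedPoints.subalgebra k S G) S G :=
  ⟨fun x hx => ⟨⟨x, hx⟩, rfl⟩⟩

/-- `S` is integral over the invariants `S^G` of a finite group (`s` is a root of the monic
`∏_{g ∈ G} (X - g • s) ∈ S^G[X]`; Mathlib `Algebra.IsInvariant.isIntegral`). [folklore] -/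
instance isIntegral_fixedPointsSubalgebra [Finite G] :
    Algebra.IsIntegral (FixedPoints.subalgebra k S G) S :=
  Algebra.IsInvariant.isIntegral (FixedPoints.subalgebra k S G) S G

/-- A finitely generated `k`-algebra is module-finite over the invariants of a finite group
(integral and of finite type). [folklore] -/
instance finite_fixedPointsSubalgebra [Finite G] [Algebra.FiniteType k S] :
    Module.Finite (FixedPoints.subalgebra k S G) S :=
  haveI : Algebra.FiniteType (FixedPoints.subalgebra k S G) S :=
    Algebra.FiniteType.of_restrictScalars_finiteType k _ S
  Algebra.IsIntegral.finite

/-- **E. Noether's finiteness theorem**: the ring of invariants `S^G` of a finite group acting by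
`k`-algebra automorphisms on a finitely generated `k`-algebra `S` is a finitely generated
`k`-algebra (Artin–Tate, Mathlib `fg_of_fg_of_fg`, applied to `k ⊆ S^G ⊆ S`). [folklore] -/
instance finiteType_fixedPointsSubalgebra [Finite G] [Algebra.FiniteType k S] :
    Algebra.FiniteType k (FixedPoints.subalgebra k S G) :=
  ⟨fg_of_fg_of_fg k (FixedPoints.subalgebra k S G) S Algebra.FiniteType.out
    (finite_fixedPointsSubalgebra k S G).1 Subtype.val_injective⟩

/-- The ring of invariants of a finite group acting on a finitely generated `k`-algebra is
Noetherian. [folklore] -/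
instance isNoetherianRing_fixedPointsSubalgebra [Finite G] [Algebra.FiniteType k S] :
    IsNoetherianRing (FixedPoints.subalgebra k S G) :=
  Algebra.FiniteType.isNoetherianRing k _

end Invariants

/-! ## Basic API of the presentation predicate -/

namespace HasFiniteQuotientSingularityPresentation

variable (k)

/-- The model: `Spec S^G` itself is presented (by the identity chart). [folklore] -/
theorem spec_fixedPoints (G : Type u) [Group G] [Finite G] (S : Type u) [CommRing S] [IsDomain S]
    [Algebra k S] [MulSemiringAction G S] [SMulCommClass G k S] [Algebra.FiniteType k S]
    [IsRegularRing S] :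
    HasFiniteQuotientSingularityPresentation k (Spec (.of (FixedPoints.subalgebra k S G))) := by
  intro y
  refine ⟨G, inferInstance, inferInstance, S, inferInstance, inferInstance, inferInstance,
    inferInstance, inferInstance, inferInstance, inferInstance, 𝟙 _, inferInstance, ?_⟩
  exact ⟨y, by simp⟩

variable {k}

/-- The notion is local on `Y`: if every point of `Y` lies in the image of an open immersion from a
presented scheme, `Y` is presented (open immersions compose). In particular it is stable under
open immersions `U ⟶ Y` from presented schemes onto open neighbourhoods covering `Y`.
[folklore] -/
theorem of_forall_exists {Y : Scheme.{u}}
    (h : ∀ y : Y, ∃ (U : Scheme.{u}) (f : U ⟶ Y), IsOpenImmersion f ∧ y ∈ Set.range f.base ∧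
      HasFiniteQuotientSingularityPresentation k U) :
    HasFiniteQuotientSingularityPresentation k Y := by
  intro y
  obtain ⟨U, f, hf, ⟨u, rfl⟩, hU⟩ := h y
  obtain ⟨G, _, _, S, _, _, _, _, _, hS, hreg, φ, hφ, ⟨x, rfl⟩⟩ := hU u
  refine ⟨G, inferInstance, inferInstance, S, inferInstance, inferInstance, inferInstance,
    inferInstance, inferInstance, hS, hreg, φ ≫ f, inferInstance, ?_⟩
  exact ⟨x, by simp [Scheme.Hom.comp_base]⟩

/-- A scheme covered by presented open subschemes is presented. [folklore] -/
theorem of_openCover {Y : Scheme.{u}} (𝒰 : Y.OpenCover)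
    (h : ∀ i, HasFiniteQuotientSingularityPresentation k (𝒰.X i)) :
    HasFiniteQuotientSingularityPresentation k Y :=
  of_forall_exists fun y => ⟨_, 𝒰.f (𝒰.idx y), inferInstance, 𝒰.covers y, h _⟩

/-- The notion is invariant under isomorphisms of schemes. [folklore] -/
theorem of_isIso {Y Y' : Scheme.{u}} (e : Y ⟶ Y') [IsIso e]
    (h : HasFiniteQuotientSingularityPresentation k Y) :
    HasFiniteQuotientSingularityPresentation k Y' :=
  of_forall_exists fun y' =>
    ⟨Y, e, inferInstance, ⟨(inv e).base y', by simp [← Scheme.Hom.comp_apply]⟩, h⟩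

variable (k)

/-- **Trivial-group case**: a regular affine `k`-variety `Spec S` (`S` a regular finitely generated
`k`-domain) is presented — by the trivial group, `S^{1} = S`. [folklore] -/
theorem spec_of_isRegularRing (S : Type u) [CommRing S] [IsDomain S] [Algebra k S]
    [Algebra.FiniteType k S] [IsRegularRing S] :
    HasFiniteQuotientSingularityPresentation k (Spec (.of S)) := by
  letI : MulSemiringAction PUnit.{u + 1} S :=
    { (inferInstance : DistribMulAction PUnit.{u + 1} S) with
      smul_one := fun _ => rfl
      smul_mul := fun _ _ _ => rfl }
  have hval : Function.Bijective (FixedPoints.subalgebra k S PUnit.{u + 1}).val :=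
    ⟨Subtype.val_injective, fun s => ⟨⟨s, fun _ => rfl⟩, rfl⟩⟩
  let e : FixedPoints.subalgebra k S PUnit.{u + 1} ≃+* S := RingEquiv.ofBijective _ hval
  exact of_isIso (Spec.map e.symm.toCommRingCatIso.hom) (spec_fixedPoints k PUnit.{u + 1} S)

variable {k}

/-- A presented scheme is locally Noetherian (its charts `Spec S^G` are spectra of Noetherian
rings, by Noether's finiteness theorem). [folklore] -/
theorem isLocallyNoetherian {Y : Scheme.{u}} (h : HasFiniteQuotientSingularityPresentation k Y) :
    IsLocallyNoetherian Y := by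
  choose G _ _ S _ _ _ _ _ hS _ φ hφ hy using h
  let 𝒰 : Y.OpenCover :=
    Scheme.Cover.mkOfCovers Y (fun y => Spec (.of (FixedPoints.subalgebra k (S y) (G y)))) φ
      (fun y => ⟨y, hy y⟩) hφ
  refine (isLocallyNoetherian_iff_openCover 𝒰).2 fun y => ?_
  haveI := hS y
  change IsLocallyNoetherian (Spec (.of (FixedPoints.subalgebra k (S y) (G y))))
  infer_instance

end HasFiniteQuotientSingularityPresentation

/-! ## Normality: regular domains, rings of invariants, stalks of presented schemes -/

section Normal

variable (k) (S : Type u) [CommRing S] [Algebra k S] (G : Type u) [Group G]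
  [MulSemiringAction G S] [SMulCommClass G k S]

/-- A regular domain is integrally closed: normality is a local property (Mathlib
`IsIntegrallyClosed.of_localization_maximal`) and regular local rings are normal (Matsumura,
Thm. 19.4, `isIntegrallyClosed_of_isRegularLocalRing`). [cite: Matsumura1987, Thm. 19.4] -/
theorem isIntegrallyClosed_of_isRegularRing (R : Type u) [CommRing R] [IsDomain R]
    [IsRegularRing R] : IsIntegrallyClosed R :=
  IsIntegrallyClosed.of_localization_maximal fun p _ _ =>
    isIntegrallyClosed_of_isRegularLocalRing (Localization.AtPrime p)

/-- The ring of invariants `S^G` of a group acting on an integrally closed domain `S` is an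
integrally closed domain: if `a/b ∈ Frac(S^G)` is integral over `S^G` then `a = b·s` with `s ∈ S`
(normality of `S`), and `s` is invariant because `a`, `b ≠ 0` are. [folklore] -/
theorem isIntegrallyClosed_fixedPointsSubalgebra [IsDomain S] [IsIntegrallyClosed S] :
    IsIntegrallyClosed (FixedPoints.subalgebra k S G) := by
  set A := FixedPoints.subalgebra k S G
  have hinj : Function.Injective (Algebra.ofId A (FractionRing S)) := by
    intro a b hab
    apply Subtype.val_injective
    apply IsFractionRing.injective S (FractionRing S)
    simpa [Algebra.ofId_apply, IsScalarTower.algebraMap_apply A S (FractionRing S)] using hab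
  let ψ : FractionRing A →ₐ[A] FractionRing S := IsFractionRing.liftAlgHom hinj
  refine (isIntegrallyClosed_iff (FractionRing A)).mpr fun {x} hx => ?_
  have h1 : IsIntegral A (ψ x) := hx.map ψ
  have h2 : IsIntegral S (ψ x) := h1.tower_top
  obtain ⟨s, hs⟩ := IsIntegrallyClosed.algebraMap_eq_of_integral h2
  obtain ⟨a, b, hb, rfl⟩ := IsFractionRing.div_surjective (A := A) x
  have hb0 : (b : S) ≠ 0 := fun h => nonZeroDivisors.ne_zero hb (Subtype.ext h)
  have hψ : ψ (algebraMap A _ a / algebraMap A _ b) =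
      algebraMap S (FractionRing S) a / algebraMap S (FractionRing S) b := by
    rw [map_div₀, ψ.commutes, ψ.commutes]
    rfl
  have hsb : s * (b : S) = (a : S) := by
    apply IsFractionRing.injective S (FractionRing S)
    rw [map_mul, hs, hψ, div_mul_cancel₀]
    exact fun h => hb0 (IsFractionRing.injective S (FractionRing S) (by rw [h, map_zero]))
  have hsA : s ∈ A := fun g => by
    have h3 : g • s * (b : S) = s * (b : S) :=
      calc g • s * (b : S) = g • s * g • (b : S) := by rw [b.2 g]
        _ = g • (s * (b : S)) := (smul_mul' g s (b : S)).symm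
        _ = g • (a : S) := by rw [hsb]
        _ = (a : S) := a.2 g
        _ = s * (b : S) := hsb.symm
    exact mul_right_cancel₀ hb0 h3
  refine ⟨⟨s, hsA⟩, ?_⟩
  have hbK : algebraMap A (FractionRing A) b ≠ 0 :=
    IsFractionRing.to_map_ne_zero_of_mem_nonZeroDivisors hb
  rw [eq_div_iff hbK, ← map_mul]
  congr 1
  exact Subtype.ext hsb

/-- The local rings of `Spec R`, `R` a domain, are domains. [folklore] -/
theorem isDomain_stalk_spec (R : CommRingCat.{u}) [IsDomain R] (x : Spec R) :
    IsDomain ((Spec R).presheaf.stalk x) := by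
  letI : Algebra R ((Spec R).presheaf.stalk x) :=
    inferInstanceAs (Algebra R ((Spec.structureSheaf R).presheaf.stalk x))
  haveI : IsLocalization.AtPrime ((Spec R).presheaf.stalk x) x.asIdeal :=
    StructureSheaf.IsLocalization.to_stalk R x
  exact IsLocalization.isDomain_of_le_nonZeroDivisors _ (Ideal.primeCompl_le_nonZeroDivisors x.asIdeal)

end Normal

namespace HasFiniteQuotientSingularityPresentation

/-- **A presented scheme is normal**: its local rings are integrally closed (regular ⇒ normal for
the `S`, invariants of normal domains are normal, and open immersions induce isomorphisms on
stalks). [folklore] -/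
theorem isIntegrallyClosed_stalk {Y : Scheme.{u}} (h : HasFiniteQuotientSingularityPresentation k Y)
    (y : Y) : IsIntegrallyClosed (Y.presheaf.stalk y) := by
  obtain ⟨G, _, _, S, _, _, _, _, _, hS, hreg, φ, hφ, ⟨x, rfl⟩⟩ := h y
  haveI : IsIntegrallyClosed S := isIntegrallyClosed_of_isRegularRing S
  haveI := isIntegrallyClosed_fixedPointsSubalgebra k S G
  haveI := Motives.isIntegrallyClosed_stalk_Spec (.of (FixedPoints.subalgebra k S G)) x
  haveI := hφ
  exact IsIntegrallyClosed.of_equiv (asIso (φ.stalkMap x)).commRingCatIsoToRingEquiv.symm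

/-- The local rings of a presented scheme are domains. [folklore] -/
theorem isDomain_stalk {Y : Scheme.{u}} (h : HasFiniteQuotientSingularityPresentation k Y)
    (y : Y) : IsDomain (Y.presheaf.stalk y) := by
  obtain ⟨G, _, _, S, _, _, _, _, _, hS, hreg, φ, hφ, ⟨x, rfl⟩⟩ := h y
  haveI := isDomain_stalk_spec (.of (FixedPoints.subalgebra k S G)) x
  haveI := hφ
  let e := (asIso (φ.stalkMap x)).commRingCatIsoToRingEquiv
  exact e.injective.isDomain e.toRingHom

end HasFiniteQuotientSingularityPresentation

/-! ## Localising a `G`-action at an invariant element; restriction to open subschemes -/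

section Localization

variable (k) {S : Type u} [CommRing S] [Algebra k S] {G : Type u} [Group G]
  [MulSemiringAction G S] [SMulCommClass G k S]

/-- A localisation of a regular ring is regular (its local rings are local rings of the original
ring). [folklore] -/
theorem isRegularRing_localization {R : Type u} [CommRing R] [IsRegularRing R]
    (M : Submonoid R) : IsRegularRing (Localization M) := by
  haveI : IsNoetherianRing (Localization M) :=
    IsLocalization.isNoetherianRing M (Localization M) inferInstance
  refine isRegularRing_iff.2 fun q _ => ?_
  exact IsRegularLocalRing.of_ringEquiv
    (IsLocalization.localizationLocalizationAtPrimeIsoLocalization M q).toRingEquiv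

variable (G) in
/-- The powers of a `G`-invariant element are stable under each `g ∈ G`. [folklore] -/
theorem powers_le_comap_toRingHom (t : S) (ht : ∀ g : G, g • t = t) (g : G) :
    Submonoid.powers t ≤ (Submonoid.powers t).comap (MulSemiringAction.toRingHom G S g) := by
  rintro _ ⟨n, rfl⟩
  exact ⟨n, by simp [smul_pow', ht g]⟩

variable (G) in
/-- The ring endomorphism `s/tⁿ ↦ (g • s)/tⁿ` of `S[1/t]` induced by `g ∈ G`, for a `G`-invariant
`t`. [folklore] -/
def smulAwayMap (t : S) (ht : ∀ g : G, g • t = t) (g : G) :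
    Localization.Away t →+* Localization.Away t :=
  IsLocalization.map (Localization.Away t) (MulSemiringAction.toRingHom G S g)
    (powers_le_comap_toRingHom G t ht g)

variable {t : S} (ht : ∀ g : G, g • t = t)

/-- `smulAwayMap g (s/1) = (g • s)/1`. [folklore] -/
@[simp]
theorem smulAwayMap_algebraMap (g : G) (s : S) :
    smulAwayMap G t ht g (algebraMap S (Localization.Away t) s) =
      algebraMap S (Localization.Away t) (g • s) := by
  simp [smulAwayMap, IsLocalization.map_eq]

/-- `smulAwayMap 1 = id`. [folklore] -/
theorem smulAwayMap_one : smulAwayMap G t ht 1 = RingHom.id _ :=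
  IsLocalization.ringHom_ext (Submonoid.powers t) <| by ext s; simp

/-- `smulAwayMap (g h) = smulAwayMap g ∘ smulAwayMap h`. [folklore] -/
theorem smulAwayMap_mul (g h : G) :
    smulAwayMap G t ht (g * h) = (smulAwayMap G t ht g).comp (smulAwayMap G t ht h) :=
  IsLocalization.ringHom_ext (Submonoid.powers t) <| by ext s; simp [mul_smul]

/-- `smulAwayMap` is `k`-linear (the action on `S` commutes with `k`). [folklore] -/
theorem smulAwayMap_smul (g : G) (c : k) (x : Localization.Away t) :
    smulAwayMap G t ht g (c • x) = c • smulAwayMap G t ht g x := by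
  rw [Algebra.smul_def, Algebra.smul_def, map_mul,
    IsScalarTower.algebraMap_apply k S (Localization.Away t), smulAwayMap_algebraMap, smul_algebraMap]

variable (G) (t) in
/-- The action of `G` on the localisation `S[1/t]` at a `G`-invariant element `t`
(`g • (s/tⁿ) = (g • s)/tⁿ`). [folklore] -/
@[reducible]
def awayMulSemiringAction : MulSemiringAction G (Localization.Away t) where
  smul g x := smulAwayMap G t ht g x
  one_smul x := by
    change smulAwayMap G t ht 1 x = x
    rw [smulAwayMap_one]
    rfl
  mul_smul g h x := by
    change smulAwayMap G t ht (g * h) x = smulAwayMap G t ht g (smulAwayMap G t ht h x)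
    rw [smulAwayMap_mul]
    rfl
  smul_zero g := map_zero (smulAwayMap G t ht g)
  smul_add g := map_add (smulAwayMap G t ht g)
  smul_one g := map_one (smulAwayMap G t ht g)
  smul_mul g := map_mul (smulAwayMap G t ht g)

/-- **Invariants commute with localisation at an invariant element**: an element of `S[1/t]` is
fixed by all `smulAwayMap g` iff it is `s/tⁿ` with `s ∈ S^G`
(`RelativeSpec.forall_apply_eq_iff_of_isLocalization`; Mumford, *Abelian Varieties*, §7, proof of
the Theorem on p. 66). [folklore] -/
theorem forall_smulAwayMap_eq_iff [Finite G] (x : Localization.Away t) :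
    (∀ g : G, smulAwayMap G t ht g x = x) ↔
      ∃ n : ℕ, ∃ s : S, (∀ g : G, g • s = s) ∧
        algebraMap S (Localization.Away t) t ^ n * x = algebraMap S (Localization.Away t) s := by
  have := RelativeSpec.forall_apply_eq_iff_of_isLocalization (B' := Localization.Away t) t
    (fun g => MulSemiringAction.toRingHom G S g) (smulAwayMap G t ht)
    (fun g b => (smulAwayMap_algebraMap ht g b).symm) (by simpa using ht) x
  simpa using this

end Localization

namespace HasFiniteQuotientSingularityPresentation

/-- **Stability under open immersions** (restriction to open subschemes): if `f : U ⟶ Y` is an open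
immersion and `Y` is presented, so is `U` — shrink a chart `Spec S^G ⟶ Y` at `f u` to a basic open
`D(a) = Spec (S^G)[1/a] = Spec (S[1/a])^G`, `a ∈ S^G`, inside `f(U)`; `S[1/a]` is again a regular
finitely generated `k`-domain with `G`-action. [folklore] -/
theorem of_isOpenImmersion {U Y : Scheme.{u}} (f : U ⟶ Y) [IsOpenImmersion f]
    (h : HasFiniteQuotientSingularityPresentation k Y) :
    HasFiniteQuotientSingularityPresentation k U := by
  intro u
  obtain ⟨G, _, _, S, _, _, _, _, _, hS, hreg, φ, hφ, ⟨x, hx⟩⟩ := h (f.base u)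
  haveI := hφ
  -- a basic open neighbourhood `D(a)` of `x` inside `φ⁻¹(f(U))`, `a = t ∈ S^G`
  have hxW : x ∈ (φ ⁻¹ᵁ f.opensRange : Set _) := ⟨u, hx.symm⟩
  obtain ⟨_, ⟨a, rfl⟩, hxa, haW⟩ :=
    PrimeSpectrum.isTopologicalBasis_basic_opens.exists_subset_of_mem_open hxW
      (φ ⁻¹ᵁ f.opensRange).isOpen
  have hxa' : a ∉ x.asIdeal := hxa
  obtain ⟨t, ht⟩ := a
  have ht' : ∀ g : G, g • t = t := ht
  have ht0 : t ≠ 0 := by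
    rintro rfl
    exact hxa' x.asIdeal.zero_mem
  -- the localised chart ring `S[1/t]` with its `G`-action: a regular f.g. `k`-domain
  letI : MulSemiringAction G (Localization.Away t) := awayMulSemiringAction G t ht'
  haveI : SMulCommClass G k (Localization.Away t) := ⟨fun g c z => smulAwayMap_smul k ht' g c z⟩
  haveI : IsDomain (Localization.Away t) :=
    IsLocalization.isDomain_localization (powers_le_nonZeroDivisors_of_noZeroDivisors ht0)
  haveI : Algebra.FiniteType k (Localization.Away t) := inferInstance
  haveI : IsRegularRing (Localization.Away t) := isRegularRing_localization _
  -- `B = (S[1/t])^G` is the localisation of `A = S^G` at `t`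
  let A : Subalgebra k S := FixedPoints.subalgebra k S G
  let B : Subalgebra k (Localization.Away t) := FixedPoints.subalgebra k (Localization.Away t) G
  let ι : A →+* B :=
    { toFun := fun b => ⟨algebraMap S (Localization.Away t) b, fun g => by
        change smulAwayMap G t ht' g _ = _
        rw [smulAwayMap_algebraMap, b.2 g]⟩
      map_one' := Subtype.ext (by simp)
      map_mul' := fun b c => Subtype.ext (by simp)
      map_zero' := Subtype.ext (by simp)
      map_add' := fun b c => Subtype.ext (by simp) }
  letI : Algebra A B := ι.toAlgebra
  have hgt : ∀ (g : G) (n : ℕ), smulAwayMap G t ht' g (algebraMap S _ (t ^ n)) =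
      algebraMap S (Localization.Away t) (t ^ n) := fun g n => by
    rw [smulAwayMap_algebraMap, smul_pow', ht' g]
  haveI : IsLocalization.Away (⟨t, ht⟩ : A) B :=
    { map_units := by
        rintro ⟨_, n, rfl⟩
        -- the inverse of `tⁿ` in `S[1/t]` is invariant
        have hu : IsUnit (algebraMap S (Localization.Away t) (t ^ n)) := by
          rw [map_pow]; exact (IsLocalization.Away.algebraMap_isUnit t).pow n
        obtain ⟨v, hv⟩ := hu.exists_left_inv
        have hvB : ∀ g : G, g • v = v := fun g => by
          change smulAwayMap G t ht' g v = v
          calc smulAwayMap G t ht' g v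
              = smulAwayMap G t ht' g v * (v * algebraMap S _ (t ^ n)) := by rw [hv, mul_one]
            _ = smulAwayMap G t ht' g v * algebraMap S _ (t ^ n) * v := by ring
            _ = smulAwayMap G t ht' g (v * algebraMap S _ (t ^ n)) * v := by rw [map_mul, hgt]
            _ = v := by rw [hv, map_one, one_mul]
        refine IsUnit.of_mul_eq_one_right ⟨v, hvB⟩ (Subtype.ext ?_)
        change v * algebraMap S (Localization.Away t) (((⟨t, ht⟩ : A) ^ n : A) : S) = 1
        simpa using hv
      surj := fun z => by
        obtain ⟨n, s, hs, hz⟩ :=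
          (forall_smulAwayMap_eq_iff ht' (z : Localization.Away t)).mp fun g => z.2 g
        refine ⟨(⟨s, hs⟩, ⟨_, n, rfl⟩), Subtype.ext ?_⟩
        change (z : Localization.Away t) * algebraMap S _ (((⟨t, ht⟩ : A) ^ n : A) : S) =
          algebraMap S _ s
        rw [mul_comm]
        simpa using hz
      exists_of_eq := by
        rintro b c hbc
        have hbc' : algebraMap S (Localization.Away t) b = algebraMap S _ c :=
          congr_arg Subtype.val hbc
        obtain ⟨⟨_, n, rfl⟩, hn⟩ := IsLocalization.exists_of_eq (M := Submonoid.powers t) hbc'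
        refine ⟨⟨_, n, rfl⟩, Subtype.ext ?_⟩
        simpa using hn }
  -- the chart `Spec B = D(t) ⟶ Spec A ⟶ Y`, lifted through `f`
  let ψ : Spec (.of B) ⟶ Spec (.of A) := Spec.map (CommRingCat.ofHom (algebraMap A B))
  haveI : IsOpenImmersion ψ := IsOpenImmersion.of_isLocalization (⟨t, ht⟩ : A)
  have hψr := PrimeSpectrum.localization_away_comap_range B (⟨t, ht⟩ : A)
  have hrange : Set.range (ψ ≫ φ).base ⊆ Set.range f.base := by
    rintro _ ⟨z, rfl⟩
    have hz : PrimeSpectrum.comap (algebraMap A B) z ∈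
        (PrimeSpectrum.basicOpen (⟨t, ht⟩ : A) : Set (PrimeSpectrum A)) := hψr ▸ ⟨z, rfl⟩
    have hz' := haW hz
    rw [Scheme.Hom.comp_apply]
    exact hz'
  let χ : Spec (.of B) ⟶ U := IsOpenImmersion.lift f (ψ ≫ φ) hrange
  have hχ : χ ≫ f = ψ ≫ φ := IsOpenImmersion.lift_fac f (ψ ≫ φ) hrange
  haveI : IsOpenImmersion (χ ≫ f) := hχ ▸ inferInstance
  haveI : IsOpenImmersion χ := IsOpenImmersion.of_comp χ f
  obtain ⟨z, hz⟩ : x ∈ Set.range (PrimeSpectrum.comap (algebraMap A B)) := by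
    rw [hψr]; exact hxa
  have hz' : ψ.base z = x := hz
  refine ⟨G, inferInstance, inferInstance, Localization.Away t, inferInstance, inferInstance,
    inferInstance, inferInstance, inferInstance, inferInstance, inferInstance, χ, inferInstance,
    z, ?_⟩
  apply f.isOpenEmbedding.injective
  calc f.base (χ.base z) = (χ ≫ f).base z := by rw [Scheme.Hom.comp_apply]
    _ = (ψ ≫ φ).base z := by rw [hχ]
    _ = φ.base (ψ.base z) := Scheme.Hom.comp_apply _ _ _
    _ = f.base u := by rw [hz', hx]

/-- Restriction to an open subscheme. [folklore] -/
theorem restrict {Y : Scheme.{u}} (h : HasFiniteQuotientSingularityPresentation k Y)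
    (V : Y.Opens) : HasFiniteQuotientSingularityPresentation k V :=
  h.of_isOpenImmersion V.ι

end HasFiniteQuotientSingularityPresentation

end Literature.AlgebraicGeometry.Resolution
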